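import Summits.ABC.IUTFork.Cor312HullGluedReal
import HarnessLib

/-!
# [IUTchIII] Cor. 3.12 — the hull-glued setting from ONE-SET STABILITY of `^{n,∘}𝒰` (the hypothesis `hHul` of
# `Cor312HullGlued` weakened to what the real DH files actually deliver), and the forms at `Setting.ofComparison`

PROOF-ONLY sequel (abc-iut cell, seat abc-iut-w5-d060, WAVE-5) of p418697 `Cor312HullGlued`, p419524
`Cor312HullGluedReal`, p417756 `Cor312HullReglue`. TAKES NO SIDE on [IUTchIII] Cor. 3.12. No definition, no `Prop` fact.

`Cor312HullGlued` derives the whole bracket (`P♮ := P.hullGlued` — print's `^{n,∘}𝒰_{j,v_ℚ} = P.thetaHull j vQ` as THE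
Θ-region at every packet — has the same packet hulls, local Θ-volumes, `−|log(Θ)|`, typed Statement; `BridgeHyps`
transported; `hθ` for free) from `hHul`: EVERY element of `indGroup S` maps EVERY hull-set `λ·𝒪_L` of the packet frame to
a hull-set. SCOPE NOTE (neutral): at the assembled Dupuy–Hilado-level real setting (`Real.settingDHVol`, abc-iut-c312-5)
the (Ind2) slot `Real.ismDH` is ALL bicontinuous lattice automorphisms of the log-shell `I_v` (Dupuy–Hilado §4.9), whose
induced maps on the field-factor side need NOT carry polydiscs to polydiscs (at a ramified `v | p` a shear of the
`ℤ_p`-lattice `𝒪_v = ℤ_p ⊕ ℤ_p·π` sends `π·𝒪_v` to `span{1+π, p}`, no ball) — so `hHul` is NOT available there in general;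
what the real files deliver (abc-iut-c312-9 `hst₀`, abc-iut-w4-d036 `factorMap_preimage_hullSet_stable_of_unramified`,
abc-iut-c312-5 `family_image_latticePk`) is stability of ONE hull-set. THIS FILE re-derives the bracket from the
strictly WEAKER hypothesis

  `hst : ∀ Φ ∈ indGroup S, Φ j vQ '' P.thetaHull j vQ = P.thetaHull j vQ`

— ONE-SET STABILITY of print's own object `^{n,∘}𝒰_{j,v_ℚ}` — at the label packets (`hHul ⇒ hst` is p417756
`Setting.image_thetaHull_eq_of_mapsHul`, restated as `stable_of_mapsHul`):

* §1 at one packet: `hullGlued_possibleImages_thetaHull_of_stable` (possible images `= {^{n,∘}𝒰}`, packet hull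
  unchanged), `hullGlued_hullDefined_thetaLocal_of_stable` / `hullGlued_hullDefined_iff_thetaLocal_of_stable` (with `hHas`,
  resp. `hHas` + the descent property `hdeg`: `HullDefined` and the local Θ-volume carried over);
* §2 globally (hypotheses at the label packets): `hullGlued_thetaFinite_negLogTheta_of_stable`,
  **`hullGlued_statement_negLogTheta_of_stable`** (`P.Statement ⇒ P♮.Statement` with the same `−|log(Θ)|`), and with
  `hdeg` the four invariants at once **`hullGlued_invariants_of_stable`** (`ThetaFinite ↔`, `−|log(Θ)| =`, `Statement ↔`,
  `C_Θ-form ↔`);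
* §3 `Cor312Vol.bridgeHyps_thetaRegionsAdm_hullGlued_of_stable` (`BridgeHyps P → BridgeHyps P♮ ∧ ThetaRegionsAdm P♮`)
  and `hullGlued_summary_of_stable`;
* §4 at abc-iut-c312-7's `Setting.ofComparison` (settings assembled over real packets, frames = the real frames pulled
  back along the comparison): with SURJECTIVE comparisons ([IUTchIII] Prop. 3.1 (i)) the frame hypotheses `hHas`/`hdeg`
  are discharged (`frameHyps_ofComparison_of_surjective`, from p418697 §5), so everything holds from `hst` + `hsurj`
  alone: **`hullGlued_invariants_ofComparison_of_stable`**, `hullGlued_summary_ofComparison_of_stable`.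
Every conclusion is stated as ONE conjunction per hypothesis set (the single-clause forms are the `hHul` twins of
p418697/p419524, which these generalise).

Reading (neutral): the trade «(Ind3)-family ↦ print's hull `^{n,∘}𝒰` at every packet» leaves both printed quantities and
the adjudicated Statement unchanged exactly where `^{n,∘}𝒰` is (Ind1),(Ind2)-STABLE (at the DH real setting: a property of
the good packets, not of the whole indeterminacy group); nothing here constrains the Θ-glue or the disputed inequality.
[claim: Mochizuki2012, status: disputed] vocabulary only. [cite: DupuyHilado2025, §4.7, §4.9]
-/

noncomputable section

open Set

namespace Summit.ABC.IUTFork.Cor312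

namespace Setting

open Thm311 Literature.IUT.LogThetaLattice

variable {T : ThetaIndex} {S : Situation T} (P : Setting S)

/-! ## 1. At one packet, under one-set stability of `^{n,∘}𝒰` -/

section AtPacket

variable {j : T.Label} {vQ : T.VQ}

/-- `hHul ⇒ hst` (p417756 `image_thetaHull_eq_of_mapsHul`); the converse fails in general, so every `_of_stable` form
below GENERALISES its `Cor312HullGlued` twin. [claim: Mochizuki2012, status: disputed] -/
theorem stable_of_mapsHul
    (hHul : ∀ Φ ∈ indGroup S, ∀ H ∈ (P.frame j vQ).Hul, Φ j vQ '' H ∈ (P.frame j vQ).Hul) :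
    ∀ Φ ∈ indGroup S, Φ j vQ '' P.thetaHull j vQ = P.thetaHull j vQ :=
  fun _ hΦ => P.image_thetaHull_eq_of_mapsHul hHul hΦ

variable (hst : ∀ Φ ∈ indGroup S, Φ j vQ '' P.thetaHull j vQ = P.thetaHull j vQ)

include hst

/-- The possible images of `P♮` at `(j, v_ℚ)` are `{^{n,∘}𝒰_{j,v_ℚ}}` and **the packet hull of `P♮` is `P`'s**
(`hull ∘ hull = hull`), once `^{n,∘}𝒰_{j,v_ℚ}` is (Ind1),(Ind2)-stable. [claim: Mochizuki2012, status: disputed] -/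
theorem hullGlued_possibleImages_thetaHull_of_stable :
    P.hullGlued.possibleImages j vQ = {P.thetaHull j vQ} ∧ P.hullGlued.thetaHull j vQ = P.thetaHull j vQ := by
  have h1 : P.hullGlued.possibleImages j vQ = {P.thetaHull j vQ} := by
    ext U
    simp only [possibleImages, hullGlued_thetaRegion3, Set.mem_setOf_eq, Set.mem_singleton_iff]
    constructor
    · rintro ⟨Φ, hΦ, rfl⟩
      exact hst Φ hΦ
    · rintro rfl
      exact ⟨1, (indGroup S).one_mem, by simp⟩
  refine ⟨h1, ?_⟩
  show (P.frame j vQ).hull (⋃₀ P.hullGlued.possibleImages j vQ) = _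
  rw [h1, Set.sUnion_singleton]
  exact (P.frame j vQ).hull_hull _

/-- `HullDefined` passes from `P` to `P♮` and **the local Θ-volume is unchanged**, when hull-sets admit hulls.
[claim: Mochizuki2012, status: disputed] -/
theorem hullGlued_hullDefined_thetaLocal_of_stable (hHas : ∀ H ∈ (P.frame j vQ).Hul, (P.frame j vQ).HasHull H)
    (hdef : P.HullDefined j vQ) :
    P.hullGlued.HullDefined j vQ ∧ P.hullGlued.thetaLocal j vQ = P.thetaLocal j vQ := by
  obtain ⟨himg, hhull⟩ := P.hullGlued_possibleImages_thetaHull_of_stable hst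
  have hdef' : P.hullGlued.HullDefined j vQ := by
    show (P.frame j vQ).IsBounded (⋃₀ P.hullGlued.possibleImages j vQ) ∧
      (P.frame j vQ).HasHull (⋃₀ P.hullGlued.possibleImages j vQ)
    rw [himg, Set.sUnion_singleton]
    exact ⟨(P.frame j vQ).hull_bounded hdef.1, hHas _ ((P.frame j vQ).hull_mem_of_hasHull hdef.1 hdef.2)⟩
  refine ⟨hdef', ?_⟩
  unfold thetaLocal
  rw [if_pos hdef', if_pos hdef, hhull]
  rfl

/-- Under the descent property `hdeg` (a bounded set whose hull admits a hull admits a hull): `HullDefined` is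
EQUIVALENT for `P♮` and `P`, and the local Θ-volume is unchanged outright. [claim: Mochizuki2012, status: disputed] -/
theorem hullGlued_hullDefined_iff_thetaLocal_of_stable (hHas : ∀ H ∈ (P.frame j vQ).Hul, (P.frame j vQ).HasHull H)
    (hdeg : ∀ U : Set (S.L.Packet j vQ), (P.frame j vQ).IsBounded U →
      (P.frame j vQ).HasHull ((P.frame j vQ).hull U) → (P.frame j vQ).HasHull U) :
    (P.hullGlued.HullDefined j vQ ↔ P.HullDefined j vQ) ∧ P.hullGlued.thetaLocal j vQ = P.thetaLocal j vQ := by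
  have hiff : P.hullGlued.HullDefined j vQ ↔ P.HullDefined j vQ := by
    refine ⟨fun h => ?_, fun h => (P.hullGlued_hullDefined_thetaLocal_of_stable hst hHas h).1⟩
    have h' : (P.frame j vQ).IsBounded (P.thetaHull j vQ) ∧ (P.frame j vQ).HasHull (P.thetaHull j vQ) := by
      have h0 : (P.frame j vQ).IsBounded (⋃₀ P.hullGlued.possibleImages j vQ) ∧
          (P.frame j vQ).HasHull (⋃₀ P.hullGlued.possibleImages j vQ) := h
      rwa [(P.hullGlued_possibleImages_thetaHull_of_stable hst).1, Set.sUnion_singleton] at h0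
    have hb : (P.frame j vQ).IsBounded (⋃₀ P.possibleImages j vQ) :=
      (P.frame j vQ).bounded_mono _ _ ((P.frame j vQ).subset_hull _) h'.1
    exact ⟨hb, hdeg _ hb h'.2⟩
  refine ⟨hiff, ?_⟩
  by_cases hdef : P.HullDefined j vQ
  · exact (P.hullGlued_hullDefined_thetaLocal_of_stable hst hHas hdef).2
  · unfold thetaLocal
    rw [if_neg hdef, if_neg fun h => hdef (hiff.1 h)]

end AtPacket

/-! ## 2. Globally: `ThetaFinite`, `−|log(Θ)|`, the Statement from one-set stability at the label packets -/

section Global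

variable
  (hst : ∀ (i : Fin T.lstar) (vQ : T.VQ), ∀ Φ ∈ indGroup S,
    Φ (labelSucc i) vQ '' P.thetaHull (labelSucc i) vQ = P.thetaHull (labelSucc i) vQ)
  (hHas : ∀ (i : Fin T.lstar) (vQ : T.VQ), ∀ H ∈ (P.frame (labelSucc i) vQ).Hul,
    (P.frame (labelSucc i) vQ).HasHull H)

include hst hHas

/-- **`ThetaFinite` passes to `P♮` and `−|log(Θ)|` is unchanged** when `P` is Θ-finite. [claim: Mochizuki2012, status: disputed] -/
theorem hullGlued_thetaFinite_negLogTheta_of_stable (hfin : P.ThetaFinite) :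
    P.hullGlued.ThetaFinite ∧ P.hullGlued.negLogTheta = P.negLogTheta := by
  have hdef : ∀ (i : Fin T.lstar) (vQ : T.VQ), P.HullDefined (labelSucc i) vQ := fun i vQ => by
    by_contra h
    exact hfin.1 i vQ (by unfold thetaLocal; rw [if_neg h])
  have hloc : ∀ (i : Fin T.lstar) (vQ : T.VQ),
      P.hullGlued.thetaLocal (labelSucc i) vQ = P.thetaLocal (labelSucc i) vQ := fun i vQ =>
    (P.hullGlued_hullDefined_thetaLocal_of_stable (hst i vQ) (hHas i vQ) (hdef i vQ)).2
  have hfin' : P.hullGlued.ThetaFinite := by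
    refine ⟨fun i vQ => ?_, fun i => ?_⟩
    · rw [hloc]; exact hfin.1 i vQ
    · simp_rw [hloc]; exact hfin.2 i
  refine ⟨hfin', ?_⟩
  unfold negLogTheta
  rw [if_pos hfin, if_pos hfin']
  simp_rw [hloc]

/-- **The typed Statement passes from `P` to `P♮`, with the same `−|log(Θ)|`.** [claim: Mochizuki2012, status: disputed] -/
theorem hullGlued_statement_negLogTheta_of_stable (h : P.Statement) :
    P.hullGlued.Statement ∧ P.hullGlued.negLogTheta = P.negLogTheta := by
  have hfin : P.ThetaFinite := by
    by_contra hf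
    exact h.1 (by unfold negLogTheta; rw [if_neg hf])
  have heq := (P.hullGlued_thetaFinite_negLogTheta_of_stable hst hHas hfin).2
  refine ⟨?_, heq⟩
  unfold Statement
  rw [heq]
  exact h

variable
  (hdeg : ∀ (i : Fin T.lstar) (vQ : T.VQ) (U : Set (S.L.Packet (labelSucc i) vQ)),
    (P.frame (labelSucc i) vQ).IsBounded U →
      (P.frame (labelSucc i) vQ).HasHull ((P.frame (labelSucc i) vQ).hull U) →
        (P.frame (labelSucc i) vQ).HasHull U)

include hdeg

/-- **The four invariants at once** under one-set stability, `hHas` and the descent property at the label packets: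
`ThetaFinite` is equivalent, `−|log(Θ)|` is EQUAL, the typed Statement of Cor. 3.12 and its `C_Θ`-form are EQUIVALENT
for `P` and its hull-glued `P♮`. [claim: Mochizuki2012, status: disputed] -/
theorem hullGlued_invariants_of_stable :
    (P.hullGlued.ThetaFinite ↔ P.ThetaFinite) ∧ P.hullGlued.negLogTheta = P.negLogTheta ∧
      (P.hullGlued.Statement ↔ P.Statement) ∧ (P.hullGlued.CThetaForm ↔ P.CThetaForm) := by
  have hloc := fun i vQ => (P.hullGlued_hullDefined_iff_thetaLocal_of_stable (hst i vQ) (hHas i vQ) (hdeg i vQ)).2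
  have hfin : P.hullGlued.ThetaFinite ↔ P.ThetaFinite := by
    unfold ThetaFinite
    simp_rw [hloc]
  have hneg : P.hullGlued.negLogTheta = P.negLogTheta := by
    unfold negLogTheta
    by_cases hf : P.ThetaFinite
    · rw [if_pos hf, if_pos (hfin.2 hf)]
      simp_rw [hloc]
    · rw [if_neg hf, if_neg fun h => hf (hfin.1 h)]
  refine ⟨hfin, hneg, ?_, ?_⟩
  · unfold Statement
    rw [hneg, P.hullGlued_negLogQ]
  · unfold CThetaForm absLogQ
    rw [hneg, P.hullGlued_negLogQ]

end Global

end Setting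

end Summit.ABC.IUTFork.Cor312

/-! ## 3. `BridgeHyps` and the summary from one-set stability -/

namespace Summit.ABC.IUTFork.Cor312Vol

open Thm311 Cor312 Cor312.Setting Literature.IUT.LogThetaLattice

variable {T : ThetaIndex} {S : Situation T} {P : Cor312.Setting S}

/-- **`BridgeHyps` is TRANSPORTED to the hull-glued setting, and `ThetaRegionsAdm` holds for it**, from one-set
stability of `^{n,∘}𝒰` and hull-sets admitting hulls at the label packets. [claim: Mochizuki2012, status: disputed] -/
theorem bridgeHyps_thetaRegionsAdm_hullGlued_of_stable (H : BridgeHyps P)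
    (hst : ∀ (i : Fin T.lstar) (vQ : T.VQ), ∀ Φ ∈ indGroup S,
      Φ (labelSucc i) vQ '' P.thetaHull (labelSucc i) vQ = P.thetaHull (labelSucc i) vQ)
    (hHas : ∀ (i : Fin T.lstar) (vQ : T.VQ), ∀ H ∈ (P.frame (labelSucc i) vQ).Hul,
      (P.frame (labelSucc i) vQ).HasHull H) :
    BridgeHyps P.hullGlued ∧ ThetaRegionsAdm P.hullGlued := by
  have himg := fun i vQ => (P.hullGlued_possibleImages_thetaHull_of_stable (hst i vQ)).1
  refine ⟨?_, thetaRegionsAdm_hullGlued fun i vQ => hullDefined_of_finite H i vQ⟩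
  exact
  { mono := H.mono
    image_adm := fun i vQ U hU => by
      rw [himg i vQ, Set.mem_singleton_iff] at hU
      rw [hU]
      exact P.thetaHull_adm (hullDefined_of_finite H i vQ)
    image_fin := fun U => by
      have hU : ∀ t : Fin T.lstar × T.VQ, U.1 t = P.thetaHull (labelSucc t.1) t.2 := fun t => by
        have h := U.2 t
        rw [himg t.1 t.2, Set.mem_singleton_iff] at h
        exact h
      have hbig : (⋃ i : Fin T.lstar, (fun vQ : T.VQ => (i, vQ)) '' Function.support fun vQ : T.VQ =>
          (P.thetaLocal (labelSucc i) vQ).untopD 0).Finite :=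
        Set.finite_iUnion fun i => (H.finite.2 i).image _
      refine hbig.subset fun t ht => ?_
      simp only [Function.mem_support, ne_eq, mul_eq_zero, not_or] at ht
      refine Set.mem_iUnion.2 ⟨t.1, ⟨t.2, ?_, rfl⟩⟩
      rw [Function.mem_support, thetaLocal_untopD H t.1 t.2, ← hU t]
      exact ht.2
    hul_nonempty := H.hul_nonempty
    theta_nonempty := fun i vQ => by
      rw [P.hullGlued_thetaRegion3]
      exact thetaHull_nonempty H (i, vQ)
    finite := (P.hullGlued_thetaFinite_negLogTheta_of_stable hst hHas H.finite).1 }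

/-- **Summary from one-set stability**: under `BridgeHyps P`, `hst`, `hHas` at the label packets, `P♮` satisfies
`BridgeHyps`, `ThetaRegionsAdm`, `hθ` at every label packet, has the SAME `−|log(Θ)|`, and its typed Statement
FOLLOWS from `P`'s. [claim: Mochizuki2012, status: disputed] -/
theorem hullGlued_summary_of_stable (H : BridgeHyps P)
    (hst : ∀ (i : Fin T.lstar) (vQ : T.VQ), ∀ Φ ∈ indGroup S,
      Φ (labelSucc i) vQ '' P.thetaHull (labelSucc i) vQ = P.thetaHull (labelSucc i) vQ)
    (hHas : ∀ (i : Fin T.lstar) (vQ : T.VQ), ∀ H ∈ (P.frame (labelSucc i) vQ).Hul,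
      (P.frame (labelSucc i) vQ).HasHull H) :
    BridgeHyps P.hullGlued ∧ ThetaRegionsAdm P.hullGlued ∧
      (∀ (i : Fin T.lstar) (vQ : T.VQ), (S.D P.n).Adm _ vQ (P.hullGlued.thetaRegion3 (labelSucc i) vQ)) ∧
      P.hullGlued.negLogTheta = P.negLogTheta ∧ (P.Statement → P.hullGlued.Statement) :=
  ⟨(bridgeHyps_thetaRegionsAdm_hullGlued_of_stable H hst hHas).1,
    (bridgeHyps_thetaRegionsAdm_hullGlued_of_stable H hst hHas).2,
    fun i vQ => P.adm_thetaRegion3_hullGlued (hullDefined_of_finite H i vQ),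
    (P.hullGlued_thetaFinite_negLogTheta_of_stable hst hHas H.finite).2,
    fun h => (P.hullGlued_statement_negLogTheta_of_stable hst hHas h).1⟩

end Summit.ABC.IUTFork.Cor312Vol

/-! ## 4. At the settings assembled over real packets (`Setting.ofComparison`): `hst` + surjectivity suffice -/

namespace Summit.ABC.IUTFork.Cor312

namespace Setting

open Thm311 Literature.IUT.LogThetaLattice Literature.IUT.LogVolume

variable {T : ThetaIndex} {S : Situation T}

variable (n : ℤ) {HT : Type} {LogLink : HT → HT → Type} {IsFull : ∀ {s t : HT}, LogLink s t → Prop}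
  (lat : LGPGaussianLogThetaLattice LogLink IsFull)
  {Frd : Type} {IsoF : Frd → Frd → Type} {Ob : Frd → Type} {realify : Frd → Frd} {Strip : Type}
  {IsoS : Strip → Strip → Type} {M : ∀ v : T.V, v ∈ T.Vbad → Type} [∀ v h, Monoid (M v h)]
  (sig : GlobalLGPFrobenioidSignature T.lstar T.V (· ∈ T.Vbad) Frd IsoF Ob realify Strip IsoS M)
  (split : SplittingMonoids M) {ObΔ : Type} {N : ∀ v : T.V, v ∈ T.Vbad → Type} [∀ v h, Monoid (N v h)]
  (qData : QPilotData ObΔ N) (R : RealPieces S (Ob sig.Clgp) ObΔ)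
  (hq : ∀ j vQ i, R.qCentre (qPilotObject qData) j vQ i ≠ 0)
  (hadm : ∀ j vQ (H : Set (∀ i, R.K j vQ i)), IsHullSet (R.K j vQ) H → (S.D n).Adm j vQ (R.e j vQ ⁻¹' H))
  (hfin : ∀ j : T.Label, (Function.support fun vQ => (S.D n).logvol j vQ
    (R.e j vQ ⁻¹' hullSet (R.K j vQ) (R.qCentre (qPilotObject qData) j vQ))).Finite)
  (hsurj : ∀ (i : Fin T.lstar) (vQ : T.VQ), Function.Surjective (R.e (labelSucc i) vQ))
  (hst : ∀ (i : Fin T.lstar) (vQ : T.VQ), ∀ Φ ∈ indGroup S,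
    Φ (labelSucc i) vQ '' (ofComparison n lat sig split qData R hq hadm hfin).thetaHull (labelSucc i) vQ =
      (ofComparison n lat sig split qData R hq hadm hfin).thetaHull (labelSucc i) vQ)

include hsurj

/-- At `Setting.ofComparison` with surjective comparisons, the two frame hypotheses `hHas`, `hdeg` hold at every label
packet (p418697 §5 at the pulled-back real frame). [claim: Mochizuki2012, status: disputed] -/
theorem frameHyps_ofComparison_of_surjective (i : Fin T.lstar) (vQ : T.VQ) :
    (∀ H ∈ ((ofComparison n lat sig split qData R hq hadm hfin).frame (labelSucc i) vQ).Hul,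
        ((ofComparison n lat sig split qData R hq hadm hfin).frame (labelSucc i) vQ).HasHull H) ∧
      (∀ U : Set (S.L.Packet (labelSucc i) vQ),
        ((ofComparison n lat sig split qData R hq hadm hfin).frame (labelSucc i) vQ).IsBounded U →
        ((ofComparison n lat sig split qData R hq hadm hfin).frame (labelSucc i) vQ).HasHull
          (((ofComparison n lat sig split qData R hq hadm hfin).frame (labelSucc i) vQ).hull U) →
        ((ofComparison n lat sig split qData R hq hadm hfin).frame (labelSucc i) vQ).HasHull U) := by
  rw [ofComparison_frame]
  exact ⟨fun H hH => HullFrame.comap_ofLocalFields_hasHull_of_mem (R.K (labelSucc i) vQ) (hsurj i vQ) hH,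
    fun U hU h => HullFrame.comap_ofLocalFields_hasHull_of_hasHull_hull (R.K (labelSucc i) vQ) (hsurj i vQ) hU h⟩

include hst

/-- **At the real frames, from one-set stability of `^{n,∘}𝒰` at the label packets**: `−|log(Θ)|` is unchanged by the
hull-gluing, and the typed Statement and its `C_Θ`-form are EQUIVALENT for the setting and its hull-gluing.
[claim: Mochizuki2012, status: disputed] -/
theorem hullGlued_invariants_ofComparison_of_stable :
    (ofComparison n lat sig split qData R hq hadm hfin).hullGlued.negLogTheta =
        (ofComparison n lat sig split qData R hq hadm hfin).negLogTheta ∧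
      ((ofComparison n lat sig split qData R hq hadm hfin).hullGlued.Statement ↔
        (ofComparison n lat sig split qData R hq hadm hfin).Statement) ∧
      ((ofComparison n lat sig split qData R hq hadm hfin).hullGlued.CThetaForm ↔
        (ofComparison n lat sig split qData R hq hadm hfin).CThetaForm) :=
  ((ofComparison n lat sig split qData R hq hadm hfin).hullGlued_invariants_of_stable hst
    (fun i vQ => (frameHyps_ofComparison_of_surjective n lat sig split qData R hq hadm hfin hsurj i vQ).1)
    (fun i vQ => (frameHyps_ofComparison_of_surjective n lat sig split qData R hq hadm hfin hsurj i vQ).2)).2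

end Setting

end Summit.ABC.IUTFork.Cor312

namespace Summit.ABC.IUTFork.Cor312Vol

open Thm311 Cor312 Cor312.Setting Literature.IUT.LogThetaLattice Literature.IUT.LogVolume

variable {T : ThetaIndex} {S : Situation T}

variable (n : ℤ) {HT : Type} {LogLink : HT → HT → Type} {IsFull : ∀ {s t : HT}, LogLink s t → Prop}
  (lat : LGPGaussianLogThetaLattice LogLink IsFull)
  {Frd : Type} {IsoF : Frd → Frd → Type} {Ob : Frd → Type} {realify : Frd → Frd} {Strip : Type}
  {IsoS : Strip → Strip → Type} {M : ∀ v : T.V, v ∈ T.Vbad → Type} [∀ v h, Monoid (M v h)]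
  (sig : GlobalLGPFrobenioidSignature T.lstar T.V (· ∈ T.Vbad) Frd IsoF Ob realify Strip IsoS M)
  (split : SplittingMonoids M) {ObΔ : Type} {N : ∀ v : T.V, v ∈ T.Vbad → Type} [∀ v h, Monoid (N v h)]
  (qData : QPilotData ObΔ N) (R : RealPieces S (Ob sig.Clgp) ObΔ)
  (hq : ∀ j vQ i, R.qCentre (qPilotObject qData) j vQ i ≠ 0)
  (hadm : ∀ j vQ (H : Set (∀ i, R.K j vQ i)), IsHullSet (R.K j vQ) H → (S.D n).Adm j vQ (R.e j vQ ⁻¹' H))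
  (hfin : ∀ j : T.Label, (Function.support fun vQ => (S.D n).logvol j vQ
    (R.e j vQ ⁻¹' hullSet (R.K j vQ) (R.qCentre (qPilotObject qData) j vQ))).Finite)
  (hsurj : ∀ (i : Fin T.lstar) (vQ : T.VQ), Function.Surjective (R.e (labelSucc i) vQ))
  (hst : ∀ (i : Fin T.lstar) (vQ : T.VQ), ∀ Φ ∈ indGroup S,
    Φ (labelSucc i) vQ '' (Setting.ofComparison n lat sig split qData R hq hadm hfin).thetaHull (labelSucc i) vQ =
      (Setting.ofComparison n lat sig split qData R hq hadm hfin).thetaHull (labelSucc i) vQ)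

include hsurj hst

/-- **Summary at the real frames from one-set stability**: under `BridgeHyps`, surjective comparisons and `hst` at
the label packets, the hull-glued setting satisfies `BridgeHyps`, `ThetaRegionsAdm`, `hθ` at every label packet, has
the same `−|log(Θ)|`, and a typed Statement and `C_Θ`-form EQUIVALENT to the original ones.
[claim: Mochizuki2012, status: disputed] -/
theorem hullGlued_summary_ofComparison_of_stable
    (H : BridgeHyps (Setting.ofComparison n lat sig split qData R hq hadm hfin)) :
    BridgeHyps (Setting.ofComparison n lat sig split qData R hq hadm hfin).hullGlued ∧
      ThetaRegionsAdm (Setting.ofComparison n lat sig split qData R hq hadm hfin).hullGlued ∧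
      (∀ (i : Fin T.lstar) (vQ : T.VQ), (S.D n).Adm _ vQ
        ((Setting.ofComparison n lat sig split qData R hq hadm hfin).hullGlued.thetaRegion3 (labelSucc i) vQ)) ∧
      (Setting.ofComparison n lat sig split qData R hq hadm hfin).hullGlued.negLogTheta =
        (Setting.ofComparison n lat sig split qData R hq hadm hfin).negLogTheta ∧
      ((Setting.ofComparison n lat sig split qData R hq hadm hfin).hullGlued.Statement ↔
        (Setting.ofComparison n lat sig split qData R hq hadm hfin).Statement) ∧
      ((Setting.ofComparison n lat sig split qData R hq hadm hfin).hullGlued.CThetaForm ↔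
        (Setting.ofComparison n lat sig split qData R hq hadm hfin).CThetaForm) :=
  have hb := bridgeHyps_thetaRegionsAdm_hullGlued_of_stable H hst
    fun i vQ => (frameHyps_ofComparison_of_surjective n lat sig split qData R hq hadm hfin hsurj i vQ).1
  ⟨hb.1, hb.2,
    fun i vQ => (Setting.ofComparison n lat sig split qData R hq hadm hfin).adm_thetaRegion3_hullGlued
      (hullDefined_of_finite H i vQ),
    hullGlued_invariants_ofComparison_of_stable n lat sig split qData R hq hadm hfin hsurj hst⟩

end Summit.ABC.IUTFork.Cor312Vol

end
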